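import Summits.Parity.BatemanHorn.Theorems.SoloInformedHooleyShiftBlocks
import Literature.NumberTheory.LFunctions.HuxleyZeroDensity

/-!
# Assembly of the blocks: telescoping in `m`, exchange of summations, truncation of the moduli

Informed soloist `solo-Parity-informed` (session 142), conjunct `BatemanHorn`, the `d ≥ 3` rung BELOW the parity
wall; sequel to `SoloInformedHooleyShiftBlocks`.

For `x` beyond `e^Δ√|g(1)|` every modulus `e > x` has `a_e(1) = 0`, and telescoping `a_e(x) = Σ_{m<x} Δa_e(m)` turns
the trilinear term into `T(e,h) = Σ_{1≤m<x} κ_e(h)·Δa_e(m)·(S^{(x+1)}_g(h;e) − S^{(m+1)}_g(h;e))`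
(`trilinearTerm_eq_sum_Ico`).  Exchanging the `e`- and `h`-summations (`sum_Ioc_sum_Icc_half_comm`) makes the
modulus sum innermost, over `(max(x,2h), E]` resp. `(max(x,2k−1), E]`; the weight `Δa_e(m)` vanishes beyond the cut
`u_m = ⌊e^Δ√max(|g(m)|,|g(m+1)|)⌋` (`locWeight_sub_eq_zero_of_cut_lt`), so each inner sum is a block of
`SoloInformedHooleyShiftBlocks.norm_block_le`, bounded by `(δ_m/|h|)·C·Φ_η(U)` for any `U ≥ u_m`
(`norm_sum_block_le`, `Φ_η(U) = 2(2+log U)(1+2log U)U^{1−η}`).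
-/

namespace Summit.Parity.BatemanHorn.Theorems

open Finset Polynomial Filter Topology

/-! ### Telescoping in `m` -/

/-- `a_e(x) = a_e(1) + Σ_{1≤m<x} Δa_e(m)`. [this work] -/
theorem locWeight_eq_add_sum_Ico (g : ℤ[X]) (Δ : ℝ) (e : ℕ) {x : ℕ} (hx : 1 ≤ x) :
    locWeight g Δ e x = locWeight g Δ e 1 + ∑ m ∈ Ico 1 x, (locWeight g Δ e (m + 1) - locWeight g Δ e m) := by
  rw [sum_Ico_succ_sub (fun m => locWeight g Δ e m) hx]
  ring

/-- **Telescoped trilinear term**: if `a_e(1) = 0` then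
`T(e,h) = Σ_{1≤m<x} κ_e(h)·Δa_e(m)·(S^{(x+1)}_g(h;e) − S^{(m+1)}_g(h;e))`. [this work] -/
theorem trilinearTerm_eq_sum_Ico (g : ℤ[X]) (Δ : ℝ) {x : ℕ} (hx : 1 ≤ x) {e : ℕ}
    (h1 : locWeight g Δ e 1 = 0) (h : ℤ) :
    trilinearTerm g Δ x e h = ∑ m ∈ Ico 1 x, modWeight e h
      * ((locWeight g Δ e (m + 1) - locWeight g Δ e m : ℝ) : ℂ)
      * (hooleySumShift g e h ((x : ℤ) + 1) - hooleySumShift g e h ((m : ℤ) + 1)) := by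
  rw [trilinearTerm_eq_modWeight_mul, locWeight_eq_add_sum_Ico g Δ e hx, h1, zero_add]
  push_cast
  rw [zero_mul, sub_zero, sum_mul, ← sum_sub_distrib, mul_sum]
  exact sum_congr rfl fun m _ => by ring

/-! ### Exchange of the modulus and frequency summations -/

/-- `Σ_{x<e≤E} Σ_{1≤h≤(e−1)/2} F(e,h) = Σ_{1≤h≤(E−1)/2} Σ_{max(x,2h)<e≤E} F(e,h)`. [folklore] -/
theorem sum_Ioc_sum_Icc_half_comm {M : Type*} [AddCommMonoid M] (F : ℕ → ℕ → M) (x E : ℕ) :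
    ∑ e ∈ Ioc x E, ∑ h ∈ Icc 1 ((e - 1) / 2), F e h
      = ∑ h ∈ Icc 1 ((E - 1) / 2), ∑ e ∈ Ioc (max x (2 * h)) E, F e h := by
  refine sum_comm' fun e h => ?_
  simp only [mem_Ioc, mem_Icc, max_lt_iff]
  omega

/-- `Σ_{x<e≤E} Σ_{1≤k≤e/2} F(e,k) = Σ_{1≤k≤E/2} Σ_{max(x,2k−1)<e≤E} F(e,k)`. [folklore] -/
theorem sum_Ioc_sum_Icc_half_comm' {M : Type*} [AddCommMonoid M] (F : ℕ → ℕ → M) (x E : ℕ) :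
    ∑ e ∈ Ioc x E, ∑ k ∈ Icc 1 (e / 2), F e k
      = ∑ k ∈ Icc 1 (E / 2), ∑ e ∈ Ioc (max x (2 * k - 1)) E, F e k := by
  refine sum_comm' fun e k => ?_
  simp only [mem_Ioc, mem_Icc, max_lt_iff]
  omega

/-! ### Truncation of the modulus range -/

/-- `a_e(n) = 0` once `e > e^Δ √|g(n)|`. [this work] -/
theorem locWeight_eq_zero_of_sqrt_lt (g : ℤ[X]) {Δ : ℝ} (hΔ : 0 < Δ) {e n : ℕ} (hn : g.eval (n : ℤ) ≠ 0)
    (hlt : Real.exp Δ * Real.sqrt ((g.eval (n : ℤ)).natAbs : ℝ) < e) : locWeight g Δ e n = 0 := by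
  apply locWeight_eq_zero g hΔ hn
  set N : ℝ := ((g.eval (n : ℤ)).natAbs : ℝ) with hN
  have hN0 : 0 ≤ N := Nat.cast_nonneg _
  have h0 : 0 ≤ Real.exp Δ * Real.sqrt N := by positivity
  have hsq : Real.sqrt N * Real.sqrt N = N := Real.mul_self_sqrt hN0
  have h1 : (Real.exp Δ * Real.sqrt N) * (Real.exp Δ * Real.sqrt N) ≤ (e : ℝ) * e :=
    mul_self_le_mul_self h0 hlt.le
  have h2 : (Real.exp Δ * Real.sqrt N) * (Real.exp Δ * Real.sqrt N) = N * Real.exp Δ ^ 2 := by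
    rw [mul_mul_mul_comm, hsq]; ring
  calc N * Real.exp Δ ^ 2 = (Real.exp Δ * Real.sqrt N) * (Real.exp Δ * Real.sqrt N) := h2.symm
    _ ≤ (e : ℝ) * e := h1
    _ = (e : ℝ) ^ 2 := (sq _).symm

/-- The cut `u_m = ⌊e^Δ √max(|g(m)|, |g(m+1)|)⌋`. [this work] -/
noncomputable def modulusCut (g : ℤ[X]) (Δ : ℝ) (m : ℕ) : ℕ :=
  ⌊Real.exp Δ * Real.sqrt (max ((g.eval (m : ℤ)).natAbs : ℝ) ((g.eval ((m + 1 : ℕ) : ℤ)).natAbs : ℝ))⌋₊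

/-- `u_m ≤ e^Δ √max(|g(m)|, |g(m+1)|)`. [this work] -/
theorem modulusCut_le (g : ℤ[X]) (Δ : ℝ) (m : ℕ) :
    (modulusCut g Δ m : ℝ)
      ≤ Real.exp Δ * Real.sqrt (max ((g.eval (m : ℤ)).natAbs : ℝ) ((g.eval ((m + 1 : ℕ) : ℤ)).natAbs : ℝ)) :=
  Nat.floor_le (by positivity)

/-- `Δa_e(m) = 0` for `e > u_m`. [this work] -/
theorem locWeight_sub_eq_zero_of_cut_lt (g : ℤ[X]) {Δ : ℝ} (hΔ : 0 < Δ) {m : ℕ} (hm : g.eval (m : ℤ) ≠ 0)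
    (hm1 : g.eval ((m + 1 : ℕ) : ℤ) ≠ 0) {e : ℕ} (he : modulusCut g Δ m < e) :
    locWeight g Δ e (m + 1) - locWeight g Δ e m = 0 := by
  set N : ℝ := ((g.eval (m : ℤ)).natAbs : ℝ) with hN
  set N' : ℝ := ((g.eval ((m + 1 : ℕ) : ℤ)).natAbs : ℝ) with hN'
  have h0 : 0 ≤ Real.exp Δ * Real.sqrt (max N N') := by positivity
  have hlt : Real.exp Δ * Real.sqrt (max N N') < e := by
    have := he
    unfold modulusCut at this
    exact (Nat.floor_lt h0).mp this
  have hNlt : Real.exp Δ * Real.sqrt N < e := lt_of_le_of_lt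
    (mul_le_mul_of_nonneg_left (Real.sqrt_le_sqrt (le_max_left _ _)) (Real.exp_pos Δ).le) hlt
  have hN'lt : Real.exp Δ * Real.sqrt N' < e := lt_of_le_of_lt
    (mul_le_mul_of_nonneg_left (Real.sqrt_le_sqrt (le_max_right _ _)) (Real.exp_pos Δ).le) hlt
  rw [locWeight_eq_zero_of_sqrt_lt g hΔ hm1 hN'lt, locWeight_eq_zero_of_sqrt_lt g hΔ hm hNlt, sub_zero]

/-! ### The block majorant `Φ_η(U)` -/

/-- `Φ_η(U) = 2(2 + log U)(1 + 2 log U)·U^{1−η}`. [this work] -/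
noncomputable def blockMajorant (η U : ℝ) : ℝ :=
  2 * (2 + Real.log U) * (1 + 2 * Real.log U) * U ^ (1 - η)

/-- `Φ_η(U) ≥ 0` for `U ≥ 1`. [this work] -/
theorem blockMajorant_nonneg (η : ℝ) {U : ℝ} (hU : 1 ≤ U) : 0 ≤ blockMajorant η U := by
  have := Real.log_nonneg hU
  unfold blockMajorant
  exact mul_nonneg (mul_nonneg (mul_nonneg (by norm_num) (by linarith)) (by linarith))
    (Real.rpow_nonneg (by linarith) _)

/-- The block factor of `norm_block_le` is at most `C·Φ_η(U)` for `E₁ ≤ U`. [this work] -/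
theorem block_factor_le {η C U : ℝ} (hη : η ≤ 1) (hC0 : 0 ≤ C) {E₁ : ℕ} (hE₁ : 1 ≤ E₁) (hU : (E₁ : ℝ) ≤ U) :
    (2 + Real.log E₁) * (2 * ((Nat.log 2 E₁ + 1 : ℕ) : ℝ) * C * (E₁ : ℝ) ^ (1 - η))
      ≤ C * blockMajorant η U := by
  have hE₁' : (1 : ℝ) ≤ E₁ := by exact_mod_cast hE₁
  have hlogE : 0 ≤ Real.log (E₁ : ℝ) := Real.log_nonneg hE₁'
  have hlog : Real.log (E₁ : ℝ) ≤ Real.log U := Real.log_le_log (by positivity) hU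
  have hk : ((Nat.log 2 E₁ + 1 : ℕ) : ℝ) ≤ 1 + 2 * Real.log U := by
    push_cast
    have := Literature.NumberTheory.LFunctions.HuxleyZeroDensity.natLog_two_le E₁ hE₁
    linarith
  have hpow : (E₁ : ℝ) ^ (1 - η) ≤ U ^ (1 - η) := Real.rpow_le_rpow (by positivity) hU (by linarith)
  have hpow0 : 0 ≤ (E₁ : ℝ) ^ (1 - η) := Real.rpow_nonneg (by positivity) _
  unfold blockMajorant
  calc (2 + Real.log E₁) * (2 * ((Nat.log 2 E₁ + 1 : ℕ) : ℝ) * C * (E₁ : ℝ) ^ (1 - η))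
      = C * (2 * ((2 + Real.log E₁) * (((Nat.log 2 E₁ + 1 : ℕ) : ℝ) * (E₁ : ℝ) ^ (1 - η)))) := by ring
    _ ≤ C * (2 * ((2 + Real.log U) * ((1 + 2 * Real.log U) * U ^ (1 - η)))) := by
        refine mul_le_mul_of_nonneg_left (mul_le_mul_of_nonneg_left ?_ (by norm_num)) hC0
        exact mul_le_mul (by linarith) (mul_le_mul hk hpow hpow0 (by linarith)) (by positivity) (by linarith)
    _ = C * (2 * (2 + Real.log U) * (1 + 2 * Real.log U) * U ^ (1 - η)) := by ring

/-! ### One block, final form -/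

/-- **One `(m, h)` block.**  For `1 ≤ m < x ≤ E₀`, `2|h| ≤ E₀ + 1`, `h ≠ 0` and any `U ≥ max(1, u_m)`:
`‖Σ_{E₀<e≤E} κ_e(h)Δa_e(m)(S^{(x+1)} − S^{(m+1)})(h;e)‖ ≤ (δ_m/|h|)·C·Φ_η(U)`. [this work] -/
theorem norm_sum_block_le {g : ℤ[X]} {η C : ℝ} (hη : η ≤ 1) (hC0 : 0 ≤ C)
    (hC : ∀ (h b : ℤ) (E E' : ℕ), h ≠ 0 → 1 ≤ E → E ≤ E' → E' ≤ 2 * E → |h| ≤ E → 0 ≤ b → b ≤ 2 * E →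
      ‖∑ e ∈ Ioc E E', hooleySumShift g e h b‖ ≤ C * (E : ℝ) ^ (1 - η))
    {Δ : ℝ} (hΔ : 0 < Δ) {x m : ℕ} (hx : 1 ≤ x) (hmx : m ∈ Ico 1 x)
    (hgm : g.eval (m : ℤ) ≠ 0) (hgm1 : g.eval ((m + 1 : ℕ) : ℤ) ≠ 0)
    {h : ℤ} (h0 : h ≠ 0) {E₀ : ℕ} (E : ℕ) (hxE₀ : x ≤ E₀) (h2 : 2 * |h| ≤ (E₀ : ℤ) + 1)
    {U : ℝ} (hU1 : 1 ≤ U) (hU : (modulusCut g Δ m : ℝ) ≤ U) :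
    ‖∑ e ∈ Ioc E₀ E, modWeight e h * ((locWeight g Δ e (m + 1) - locWeight g Δ e m : ℝ) : ℂ)
        * (hooleySumShift g e h ((x : ℤ) + 1) - hooleySumShift g e h ((m : ℤ) + 1))‖
      ≤ |Real.log ((g.eval ((m + 1 : ℕ) : ℤ)).natAbs : ℝ) - Real.log ((g.eval (m : ℤ)).natAbs : ℝ)| / (4 * Δ)
          / |(h : ℝ)| * (C * blockMajorant η U) := by
  rw [mem_Ico] at hmx
  have hE₀ : 1 ≤ E₀ := hx.trans hxE₀
  have hΦ := blockMajorant_nonneg η hU1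
  set F : ℕ → ℂ := fun e => modWeight e h * ((locWeight g Δ e (m + 1) - locWeight g Δ e m : ℝ) : ℂ)
    * (hooleySumShift g e h ((x : ℤ) + 1) - hooleySumShift g e h ((m : ℤ) + 1)) with hF
  have hF0 : ∀ e, modulusCut g Δ m < e → F e = 0 := by
    intro e he
    simp only [hF, locWeight_sub_eq_zero_of_cut_lt g hΔ hgm hgm1 he, Complex.ofReal_zero, mul_zero, zero_mul]
  by_cases hcut : modulusCut g Δ m ≤ E₀
  · have hz : ∑ e ∈ Ioc E₀ E, F e = 0 :=
      sum_eq_zero fun e he => hF0 e (by rw [mem_Ioc] at he; omega)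
    rw [hz, norm_zero]
    positivity
  rw [not_le] at hcut
  set E₁ : ℕ := max E₀ (min E (modulusCut g Δ m)) with hE₁
  have hE₀E₁ : E₀ ≤ E₁ := le_max_left _ _
  have hE₁cut : E₁ ≤ modulusCut g Δ m := by omega
  have hE₁U : (E₁ : ℝ) ≤ U := le_trans (by exact_mod_cast hE₁cut) hU
  have hsub : ∑ e ∈ Ioc E₀ E, F e = ∑ e ∈ Ioc E₀ E₁, F e := by
    symm
    refine sum_subset (fun e he => ?_) (fun e he hne => ?_)
    · rw [mem_Ioc] at he ⊢; omega
    · rw [mem_Ioc] at he hne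
      exact hF0 e (by omega)
  rw [hsub]
  have hb := norm_block_le hη hC0 hC hΔ hgm hgm1 h0 hE₀ h2 hE₀E₁ (b₁ := (x : ℤ) + 1) (b₂ := (m : ℤ) + 1)
    (by omega) (by omega) (by omega) (by omega)
  refine hb.trans ?_
  rw [mul_assoc]
  exact mul_le_mul_of_nonneg_left (block_factor_le hη hC0 (hE₀.trans hE₀E₁) hE₁U) (by positivity)

end Summit.Parity.BatemanHorn.Theorems
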